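import Mathlib
import HarnessLib
import Literature.MathematicalPhysics.QuantumManyBody.BoseGasFreeDirichletBEC
import Summits.AtomisticToContinuum.BoseEinsteinCondensation.Theses.NumberPhaseSandwich
import Summits.AtomisticToContinuum.BoseEinsteinCondensation.Theorems.NumberPhaseSandwichLossBookkeepingCells

/-!
# Route NumberPhaseSandwich — support item `LossBookkeeping` (stmt-AtomisticToContinuum-32640), part 2/2: SLICES, DIPOLE BOUND, HALF-PARENT PARSEVAL

Port (decomp-a2c census g7) of lens-6 g10's `LossBookkeepingProof.lean` (sha256 55ccb75b…): slices of admissible states are integrable, the dipole occupation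
formula `occupation_dip_eq`, (b) dip(c,c′) ≤ 2(n_c + n_{c′}) (`dip_le_two_mul`), (a) the half-parent Parseval inequality
S_k ≤ S_{k−1} + 16⁻¹ Σ_c Σ_{c′ sib ≠ c} dip(c,c′) (`level_sum_le`), and `lossBookkeeping : …Theses.NumberPhaseSandwich.LossBookkeeping` BY NAME.
-/

noncomputable section

namespace Summit.AtomisticToContinuum.BoseEinsteinCondensation.Theorems.NumberPhaseSandwichLossBookkeeping

open Literature.MathematicalPhysics.QuantumManyBody.BoseGas Finset MeasureTheory
open scoped NNReal ENNReal
open Summit.AtomisticToContinuum.BoseEinsteinCondensation.Theorems.NumberPhaseSandwichLossBookkeepingCells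

/-! ## Slices of admissible states -/

variable {n : ℕ} {L : ℝ}

/-- the slice `x ↦ Ψ(x, Y)`. -/
def slice (Ψ : Config (n + 1) → ℂ) (Y : Config n) (x : Space) : ℂ := Ψ (Matrix.vecCons x Y)

/-- Helper `continuous_slice` (ported verbatim from the lens-6 g10 kernel file). -/
theorem continuous_slice {Ψ : Config (n + 1) → ℂ} (hΨ : Continuous Ψ) (Y : Config n) :
    Continuous (slice Ψ Y) :=
  hΨ.comp (continuous_id.matrixVecCons continuous_const)

/-- Helper `hasCompactSupport_slice` (ported verbatim from the lens-6 g10 kernel file). -/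
theorem hasCompactSupport_slice (Ψ : TrialState (n + 1) L) (Y : Config n) :
    HasCompactSupport (slice Ψ.ψ Y) := by
  -- the box of side `L` is bounded (inlined; a standalone lemma would duplicate a landed decl name)
  have hbox : Bornology.IsBounded (box L) := by
    rw [isBounded_iff_forall_norm_le]
    refine ⟨Real.sqrt (3 * L ^ 2), fun x hx => ?_⟩
    rw [EuclideanSpace.norm_eq]
    apply Real.sqrt_le_sqrt
    have h : ∀ i, ‖x i‖ ^ 2 ≤ L ^ 2 := fun i => by
      obtain ⟨h1, h2⟩ := hx i
      rw [Real.norm_eq_abs, sq_abs]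
      nlinarith
    calc ∑ i, ‖x i‖ ^ 2 ≤ ∑ _i : Fin 3, L ^ 2 := Finset.sum_le_sum fun i _ => h i
      _ = 3 * L ^ 2 := by simp
  refine HasCompactSupport.intro hbox.isCompact_closure fun x hx => ?_
  refine Ψ.eq_zero _ fun hX => hx (subset_closure ?_)
  simpa using hX 0

/-- Helper `integrable_slice` (ported verbatim from the lens-6 g10 kernel file). -/
theorem integrable_slice (Ψ : TrialState (n + 1) L) (Y : Config n) :
    Integrable fun x => Ψ.ψ (Matrix.vecCons x Y) :=
  (continuous_slice Ψ.contDiff.continuous Y).integrable_of_hasCompactSupport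
    (hasCompactSupport_slice Ψ Y)

/-- the cell integral `J_Q(Y) = ∫_Q Ψ(x, Y) dx`. -/
def J (Ψ : Config (n + 1) → ℂ) (Q : Set Space) (Y : Config n) : ℂ := ∫ x in Q, Ψ (Matrix.vecCons x Y)

/-- Helper `stronglyMeasurable_J` (ported verbatim from the lens-6 g10 kernel file). -/
theorem stronglyMeasurable_J {Ψ : Config (n + 1) → ℂ} (hΨ : Continuous Ψ) (Q : Set Space) :
    StronglyMeasurable (J Ψ Q) := by
  have h : StronglyMeasurable
      (Function.uncurry fun (Y : Config n) (x : Space) => Ψ (Matrix.vecCons x Y)) :=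
    (hΨ.comp (continuous_snd.matrixVecCons continuous_fst)).stronglyMeasurable
  exact h.integral_prod_right' (ν := volume.restrict Q)

/-- Helper `measurable_nnnorm_sq_of_sm` (ported verbatim from the lens-6 g10 kernel file). -/
theorem measurable_nnnorm_sq_of_sm {f : Config n → ℂ} (hf : StronglyMeasurable f) :
    Measurable fun Y => ((‖f Y‖₊ : ℝ≥0∞) ^ 2) :=
  (hf.measurable.nnnorm.coe_nnreal_ennreal).pow_const _

/-- integrability of `conj(u_q) · Ψ(·, Y)`. -/
theorem integrable_conj_subMode_mul (ℓ : ℝ) {k : ℕ} (q : SubIdx k) (Ψ : TrialState (n + 1) L)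
    (Y : Config n) : Integrable fun x => (starRingEnd ℂ) (subMode ℓ q x) * Ψ.ψ (Matrix.vecCons x Y) := by
  refine (integrable_slice Ψ Y).bdd_mul (c := ‖((Real.sqrt (ℓ ^ 3))⁻¹ : ℂ)‖)
    (Complex.continuous_conj.comp_aestronglyMeasurable (aestronglyMeasurable_subMode ℓ q))
    (Filter.Eventually.of_forall fun x => ?_)
  rw [Complex.norm_conj, subMode_eq_indicator]
  exact norm_indicator_le_norm_self _ _

/-- the pairing with a difference of two sub-cell modes. -/
theorem integral_conj_sub_subMode_mul {ℓ : ℝ} {k : ℕ} (c c' : SubIdx k) (Ψ : TrialState (n + 1) L)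
    (Y : Config n) :
    ∫ x, (starRingEnd ℂ) (subMode ℓ c x - subMode ℓ c' x) * Ψ.ψ (Matrix.vecCons x Y) =
      ((Real.sqrt (ℓ ^ 3))⁻¹ : ℂ) * (J Ψ.ψ (subCell ℓ c) Y - J Ψ.ψ (subCell ℓ c') Y) := by
  simp only [map_sub, sub_mul]
  rw [integral_sub (integrable_conj_subMode_mul ℓ c Ψ Y) (integrable_conj_subMode_mul ℓ c' Ψ Y),
    integral_conj_subMode_mul, integral_conj_subMode_mul, mul_sub]
  rfl

/-- **Occupation of the dipole mode** `u_c - u_{c'}` through slices. -/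
theorem occupation_dip_eq {ℓ : ℝ} (hℓ : 0 < ℓ) {k : ℕ} (c c' : SubIdx k) (Ψ : TrialState (n + 1) L) :
    occupation (n + 1) (fun x => subMode ℓ c x - subMode ℓ c' x) Ψ.ψ =
      (n + 1 : ℝ≥0∞) * ∫⁻ Y : Config n, (ENNReal.ofReal ℓ ^ 3)⁻¹ *
        (‖J Ψ.ψ (subCell ℓ c) Y - J Ψ.ψ (subCell ℓ c') Y‖₊ : ℝ≥0∞) ^ 2 := by
  unfold occupation
  push_cast
  congr 1
  refine lintegral_congr fun Y => ?_
  rw [integral_conj_sub_subMode_mul, nnnorm_mul, ENNReal.coe_mul, mul_pow, nnnorm_constantMode_sq hℓ]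

/-- occupation of a sub-cell mode through `J`. -/
theorem occupation_subMode_J {ℓ : ℝ} (hℓ : 0 < ℓ) {k : ℕ} (c : SubIdx k) (Ψ : TrialState (n + 1) L) :
    occupation (n + 1) (subMode ℓ c) Ψ.ψ =
      (n + 1 : ℝ≥0∞) * ∫⁻ Y : Config n, (ENNReal.ofReal ℓ ^ 3)⁻¹ *
        (‖J Ψ.ψ (subCell ℓ c) Y‖₊ : ℝ≥0∞) ^ 2 :=
  occupation_subMode hℓ c Ψ.ψ

/-- `‖a - b‖² ≤ 2(‖a‖² + ‖b‖²)` in `ℝ≥0∞`. -/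
theorem ennnorm_sub_sq_le (a b : ℂ) :
    ((‖a - b‖₊ : ℝ≥0∞) ^ 2) ≤ 2 * ((‖a‖₊ : ℝ≥0∞) ^ 2 + (‖b‖₊ : ℝ≥0∞) ^ 2) := by
  have h : (‖a - b‖₊ ^ 2 : ℝ≥0) ≤ 2 * (‖a‖₊ ^ 2 + ‖b‖₊ ^ 2) := by
    rw [← NNReal.coe_le_coe]; push_cast
    have h1 : ‖a - b‖ ^ 2 ≤ (‖a‖ + ‖b‖) ^ 2 := pow_le_pow_left₀ (norm_nonneg _) (norm_sub_le a b) 2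
    nlinarith [sq_nonneg (‖a‖ - ‖b‖)]
  have h' := ENNReal.coe_le_coe.2 h
  push_cast at h'
  exact h'

/-- **LossBookkeeping (b)**: `dip(c,c') ≤ 2 (n_c + n_{c'})`. -/
theorem dip_le_two_mul {N : ℕ} {L : ℝ} {ℓ : ℝ} (hℓ : 0 < ℓ) {k : ℕ} (c c' : SubIdx k)
    (Ψ : TrialState N L) :
    occupation N (fun x => subMode ℓ c x - subMode ℓ c' x) Ψ.ψ ≤
      2 * (occupation N (subMode ℓ c) Ψ.ψ + occupation N (subMode ℓ c') Ψ.ψ) := by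
  rcases N with _ | n
  · simp [occupation]
  rw [occupation_dip_eq hℓ, occupation_subMode_J hℓ, occupation_subMode_J hℓ, ← mul_add,
    mul_left_comm]
  gcongr
  have hm : ∀ d : SubIdx k, Measurable fun Y : Config n =>
      (ENNReal.ofReal ℓ ^ 3)⁻¹ * ((‖J Ψ.ψ (subCell ℓ d) Y‖₊ : ℝ≥0∞) ^ 2) := fun d =>
    (measurable_nnnorm_sq_of_sm (stronglyMeasurable_J Ψ.contDiff.continuous _)).const_mul _
  rw [← lintegral_add_left (hm c)]
  calc ∫⁻ Y, (ENNReal.ofReal ℓ ^ 3)⁻¹ *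
          ((‖J Ψ.ψ (subCell ℓ c) Y - J Ψ.ψ (subCell ℓ c') Y‖₊ : ℝ≥0∞) ^ 2)
        ≤ ∫⁻ Y, 2 * ((ENNReal.ofReal ℓ ^ 3)⁻¹ * ((‖J Ψ.ψ (subCell ℓ c) Y‖₊ : ℝ≥0∞) ^ 2) +
            (ENNReal.ofReal ℓ ^ 3)⁻¹ * ((‖J Ψ.ψ (subCell ℓ c') Y‖₊ : ℝ≥0∞) ^ 2)) :=
          lintegral_mono fun Y => by
            rw [← mul_add, mul_left_comm]
            gcongr
            exact ennnorm_sub_sq_le _ _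
    _ = 2 * ∫⁻ Y, ((ENNReal.ofReal ℓ ^ 3)⁻¹ * ((‖J Ψ.ψ (subCell ℓ c) Y‖₊ : ℝ≥0∞) ^ 2) +
            (ENNReal.ofReal ℓ ^ 3)⁻¹ * ((‖J Ψ.ψ (subCell ℓ c') Y‖₊ : ℝ≥0∞) ^ 2)) :=
          lintegral_const_mul 2 ((hm c).add (hm c'))


/-! ## LossBookkeeping (a): the half-parent Parseval inequality -/

/-- the parent cell integral is the sum of the children's. -/
theorem J_parent_eq {k : ℕ} (hk : 1 ≤ k) {ℓ : ℝ} (hℓ : 0 < ℓ) (P : SubIdx (2 ^ (k - 1)))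
    (Ψ : TrialState (n + 1) L) (Y : Config n) :
    J Ψ.ψ (subCell (2 * ℓ) P) Y = ∑ c ∈ children P, J Ψ.ψ (subCell ℓ c) Y := by
  unfold J
  rw [subCell_parent_eq hk hℓ P, integral_biUnion_finset _ (fun c _ => measurableSet_subCell ℓ c)
    (pairwiseDisjoint_children hℓ P) (fun c _ => (integrable_slice Ψ Y).integrableOn)]

/-- Helper `kappa_two_mul` (ported verbatim from the lens-6 g10 kernel file). -/
theorem kappa_two_mul (ℓ : ℝ) :
    (ENNReal.ofReal (2 * ℓ) ^ 3)⁻¹ = 8⁻¹ * (ENNReal.ofReal ℓ ^ 3)⁻¹ := by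
  rw [ENNReal.ofReal_mul (by norm_num : (0:ℝ) ≤ 2), mul_pow, ENNReal.ofReal_ofNat,
    ENNReal.mul_inv (Or.inl (by norm_num)) (Or.inl (by norm_num))]
  norm_num

/-- pointwise key inequality in `Y`. -/
theorem key_pointwise {k : ℕ} (hk : 1 ≤ k) {ℓ : ℝ} (hℓ : 0 < ℓ) (P : SubIdx (2 ^ (k - 1)))
    (Ψ : TrialState (n + 1) L) (Y : Config n) :
    ∑ c ∈ children P, (ENNReal.ofReal ℓ ^ 3)⁻¹ * ((‖J Ψ.ψ (subCell ℓ c) Y‖₊ : ℝ≥0∞) ^ 2) ≤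
      (ENNReal.ofReal (2 * ℓ) ^ 3)⁻¹ * ((‖J Ψ.ψ (subCell (2 * ℓ) P) Y‖₊ : ℝ≥0∞) ^ 2) +
        16⁻¹ * ∑ c ∈ children P, ∑ c' ∈ children P, (ENNReal.ofReal ℓ ^ 3)⁻¹ *
          ((‖J Ψ.ψ (subCell ℓ c) Y - J Ψ.ψ (subCell ℓ c') Y‖₊ : ℝ≥0∞) ^ 2) := by
  have h := parseval_ennreal_le (children P) (eight_le_card_children hk P)
    (fun c => J Ψ.ψ (subCell ℓ c) Y)
  rw [J_parent_eq hk hℓ P Ψ Y, kappa_two_mul ℓ, ← Finset.mul_sum]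
  calc (ENNReal.ofReal ℓ ^ 3)⁻¹ * ∑ c ∈ children P, ((‖J Ψ.ψ (subCell ℓ c) Y‖₊ : ℝ≥0∞) ^ 2)
      ≤ (ENNReal.ofReal ℓ ^ 3)⁻¹ * (8⁻¹ * (‖∑ c ∈ children P, J Ψ.ψ (subCell ℓ c) Y‖₊ : ℝ≥0∞) ^ 2 +
          16⁻¹ * ∑ c ∈ children P, ∑ c' ∈ children P,
            ((‖J Ψ.ψ (subCell ℓ c) Y - J Ψ.ψ (subCell ℓ c') Y‖₊ : ℝ≥0∞) ^ 2)) := by gcongr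
    _ = _ := by
      rw [mul_add]
      congr 1
      · ring
      · rw [Finset.mul_sum, Finset.mul_sum, Finset.mul_sum]
        refine Finset.sum_congr rfl fun c _ => ?_
        rw [Finset.mul_sum, Finset.mul_sum, Finset.mul_sum]
        refine Finset.sum_congr rfl fun c' _ => ?_
        ring

/-- per-parent inequality. -/
theorem children_occupation_le {k : ℕ} (hk : 1 ≤ k) {ℓ : ℝ} (hℓ : 0 < ℓ) (P : SubIdx (2 ^ (k - 1)))
    (Ψ : TrialState (n + 1) L) :
    ∑ c ∈ children P, occupation (n + 1) (subMode ℓ c) Ψ.ψ ≤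
      occupation (n + 1) (subMode (2 * ℓ) P) Ψ.ψ +
        16⁻¹ * ∑ c ∈ children P, ∑ c' ∈ children P,
          occupation (n + 1) (fun x => subMode ℓ c x - subMode ℓ c' x) Ψ.ψ := by
  have h2ℓ : 0 < 2 * ℓ := by positivity
  have hΨc : Continuous Ψ.ψ := Ψ.contDiff.continuous
  have hmJ : ∀ (Q : Set Space), Measurable fun Y : Config n =>
      (ENNReal.ofReal ℓ ^ 3)⁻¹ * ((‖J Ψ.ψ Q Y‖₊ : ℝ≥0∞) ^ 2) := fun Q =>
    (measurable_nnnorm_sq_of_sm (stronglyMeasurable_J hΨc Q)).const_mul _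
  have hmP : Measurable fun Y : Config n =>
      (ENNReal.ofReal (2 * ℓ) ^ 3)⁻¹ * ((‖J Ψ.ψ (subCell (2 * ℓ) P) Y‖₊ : ℝ≥0∞) ^ 2) :=
    (measurable_nnnorm_sq_of_sm (stronglyMeasurable_J hΨc _)).const_mul _
  have hmD : ∀ c c' : SubIdx (2 ^ k), Measurable fun Y : Config n =>
      (ENNReal.ofReal ℓ ^ 3)⁻¹ *
        ((‖J Ψ.ψ (subCell ℓ c) Y - J Ψ.ψ (subCell ℓ c') Y‖₊ : ℝ≥0∞) ^ 2) := fun c c' =>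
    (measurable_nnnorm_sq_of_sm ((stronglyMeasurable_J hΨc _).sub (stronglyMeasurable_J hΨc _))).const_mul _
  have hmS : Measurable fun Y : Config n => ∑ c ∈ children P, ∑ c' ∈ children P,
      (ENNReal.ofReal ℓ ^ 3)⁻¹ *
        ((‖J Ψ.ψ (subCell ℓ c) Y - J Ψ.ψ (subCell ℓ c') Y‖₊ : ℝ≥0∞) ^ 2) :=
    Finset.measurable_sum _ fun c _ => Finset.measurable_sum _ fun c' _ => hmD c c'
  -- the three blocks as `(n+1) * ∫⁻`
  have hL : ∑ c ∈ children P, occupation (n + 1) (subMode ℓ c) Ψ.ψ =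
      (n + 1 : ℝ≥0∞) * ∫⁻ Y, ∑ c ∈ children P,
        (ENNReal.ofReal ℓ ^ 3)⁻¹ * ((‖J Ψ.ψ (subCell ℓ c) Y‖₊ : ℝ≥0∞) ^ 2) := by
    rw [lintegral_finsetSum _ (fun c _ => hmJ _), Finset.mul_sum]
    exact Finset.sum_congr rfl fun c _ => occupation_subMode_J hℓ c Ψ
  have hD : ∑ c ∈ children P, ∑ c' ∈ children P,
      occupation (n + 1) (fun x => subMode ℓ c x - subMode ℓ c' x) Ψ.ψ =
      (n + 1 : ℝ≥0∞) * ∫⁻ Y, ∑ c ∈ children P, ∑ c' ∈ children P,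
        (ENNReal.ofReal ℓ ^ 3)⁻¹ *
          ((‖J Ψ.ψ (subCell ℓ c) Y - J Ψ.ψ (subCell ℓ c') Y‖₊ : ℝ≥0∞) ^ 2) := by
    rw [lintegral_finsetSum _ (fun c _ => Finset.measurable_sum _ fun c' _ => hmD c c'),
      Finset.mul_sum]
    refine Finset.sum_congr rfl fun c _ => ?_
    rw [lintegral_finsetSum _ (fun c' _ => hmD c c'), Finset.mul_sum]
    exact Finset.sum_congr rfl fun c' _ => occupation_dip_eq hℓ c c' Ψ
  rw [hL, hD, occupation_subMode_J h2ℓ]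
  calc (n + 1 : ℝ≥0∞) * ∫⁻ Y, ∑ c ∈ children P,
          (ENNReal.ofReal ℓ ^ 3)⁻¹ * ((‖J Ψ.ψ (subCell ℓ c) Y‖₊ : ℝ≥0∞) ^ 2)
      ≤ (n + 1 : ℝ≥0∞) * ∫⁻ Y, ((ENNReal.ofReal (2 * ℓ) ^ 3)⁻¹ *
            ((‖J Ψ.ψ (subCell (2 * ℓ) P) Y‖₊ : ℝ≥0∞) ^ 2) +
          16⁻¹ * ∑ c ∈ children P, ∑ c' ∈ children P, (ENNReal.ofReal ℓ ^ 3)⁻¹ *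
            ((‖J Ψ.ψ (subCell ℓ c) Y - J Ψ.ψ (subCell ℓ c') Y‖₊ : ℝ≥0∞) ^ 2)) := by
        gcongr with Y
        exact key_pointwise hk hℓ P Ψ Y
    _ = _ := by
        rw [lintegral_add_left hmP, lintegral_const_mul _ hmS]
        ring

/-- the sibling double sum of the route statement equals the children double sum. -/
theorem sibling_sum_eq {k : ℕ} {M : Type*} [AddCommMonoid M] (F : SubIdx (2 ^ k) → SubIdx (2 ^ k) → M)
    (hdiag : ∀ c, F c c = 0) :
    ∑ c : SubIdx (2 ^ k), ∑ c' ∈ Finset.univ.filter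
        (fun c' : SubIdx (2 ^ k) => c ≠ c' ∧ ∀ j : Fin 3, (c j : ℕ) / 2 = (c' j : ℕ) / 2), F c c' =
      ∑ P : SubIdx (2 ^ (k - 1)), ∑ c ∈ children P, ∑ c' ∈ children P, F c c' := by
  have h1 : ∀ c : SubIdx (2 ^ k), ∑ c' ∈ Finset.univ.filter
      (fun c' : SubIdx (2 ^ k) => c ≠ c' ∧ ∀ j : Fin 3, (c j : ℕ) / 2 = (c' j : ℕ) / 2), F c c' =
      ∑ c' ∈ children (par c), F c c' := by
    intro c
    have hset : Finset.univ.filter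
        (fun c' : SubIdx (2 ^ k) => c ≠ c' ∧ ∀ j : Fin 3, (c j : ℕ) / 2 = (c' j : ℕ) / 2) =
        (children (par c)).erase c := by
      ext c'
      simp only [Finset.mem_filter, Finset.mem_univ, true_and, Finset.mem_erase, mem_children,
        sib_iff]
      constructor
      · rintro ⟨hne, h⟩; exact ⟨Ne.symm hne, h.symm⟩
      · rintro ⟨hne, h⟩; exact ⟨Ne.symm hne, h.symm⟩
    rw [hset, Finset.sum_erase _ (hdiag c)]
  simp_rw [h1]
  rw [sum_eq_sum_children]
  refine Finset.sum_congr rfl fun P _ => Finset.sum_congr rfl fun c hc => ?_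
  rw [mem_children.1 hc]

/-- `dip(c,c) = 0`. -/
theorem occupation_dip_self {N : ℕ} {ℓ : ℝ} {k : ℕ} (c : SubIdx k) (Ψ : Config N → ℂ) :
    occupation N (fun x => subMode ℓ c x - subMode ℓ c x) Ψ = 0 := by
  rcases N with _ | n
  · simp [occupation]
  · simp [occupation]

/-- **LossBookkeeping (a)**: `S_k ≤ S_{k-1} + 16⁻¹ ∑_c ∑_{c' sibling ≠ c} dip(c,c')`. -/
theorem level_sum_le {N : ℕ} {L : ℝ} (hL : 0 < L) (Ψ : TrialState N L) {k : ℕ} (hk : 1 ≤ k) :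
    ∑ q' : SubIdx (2 ^ k), occupation N (subMode (L / 2 ^ k) q') Ψ.ψ ≤
      (∑ q' : SubIdx (2 ^ (k - 1)), occupation N (subMode (L / 2 ^ (k - 1)) q') Ψ.ψ) +
        (16 : ℝ≥0∞)⁻¹ * ∑ c : SubIdx (2 ^ k), ∑ c' ∈ Finset.univ.filter
          (fun c' : SubIdx (2 ^ k) => c ≠ c' ∧ ∀ j : Fin 3, (c j : ℕ) / 2 = (c' j : ℕ) / 2),
          occupation N (fun x => subMode (L / 2 ^ k) c x - subMode (L / 2 ^ k) c' x) Ψ.ψ := by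
  rcases N with _ | n
  · simp [occupation]
  have hℓ : 0 < L / 2 ^ k := by positivity
  have hℓ' : L / 2 ^ (k - 1) = 2 * (L / 2 ^ k) := by
    obtain ⟨k', rfl⟩ := Nat.exists_eq_add_of_le' hk
    simp only [Nat.add_sub_cancel, pow_succ]
    field_simp
  rw [sibling_sum_eq _ (fun c => occupation_dip_self c Ψ.ψ), hℓ', sum_eq_sum_children,
    Finset.mul_sum, ← Finset.sum_add_distrib]
  exact Finset.sum_le_sum fun P _ => children_occupation_le hk hℓ P Ψ


/-! ## The route item, by name -/

/-- **`LossBookkeeping` holds** (route NumberPhaseSandwich, item stmt-AtomisticToContinuum-32640). -/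
theorem lossBookkeeping :
    Summit.AtomisticToContinuum.BoseEinsteinCondensation.Theses.NumberPhaseSandwich.LossBookkeeping :=
  fun N L hL Ψ k hk => ⟨level_sum_le hL Ψ hk, fun c c' => dip_le_two_mul (by positivity) c c' Ψ⟩


end Summit.AtomisticToContinuum.BoseEinsteinCondensation.Theorems.NumberPhaseSandwichLossBookkeeping

end
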